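import Literature.Analysis.FluidPDE.TorusNSHeatFlowCriterion
import Literature.Analysis.FluidPDE.PassiveScalarWellPosednessProofs
import Literature.Analysis.FluidPDE.PassiveScalarClassicalEnergy
import HarnessLib

/-!
# The heat flow of a smooth vector field on the flat torus: classical solution, incompressibility,
# mean, uniqueness

Analysis/FluidPDE proof file (theorems only; no definitions, no named facts).
Search for candidate a priori estimates; no regularity claim.

For `ν > 0`, `T > 0` and a smooth vector field `u₀ : T^d → ℝ^d` the Cauchy problem for the heat
equation `∂ₜv = νΔv`, `v(0) = u₀` has a classical solution jointly smooth on `[0, T] × T^d`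
(one-sided time derivative within `[0, T]`), unique among such solutions; if `div u₀ = 0` then
`div v(t) = 0`, and if `∫u₀ = 0` then `∫v(t) = 0`, for all `t ∈ [0, T]` (Evans 2010, §2.3.1 and
§7.1; on the torus the divergence and the mean are themselves solutions of the scalar heat
equation, with zero data). This is the object entering Robinson–Sadowski's local smoothness
criterion (Rend. Semin. Mat. Univ. Padova 131 (2014), (4) and Theorem 5: "`v(t)` is the solution
of the heat equation with initial data `u₀`"; "the divergence-free property of `u₀` is preserved
by the heat semigroup", p. 161), typed in `TorusNSHeatFlowCriterion` with the heat flow as a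
hypothesis; the present file discharges that hypothesis:

* `Torus.exists_classical_heatFlow` — existence on `[0, T]` with the three properties and
  uniqueness, assembled componentwise from the tree's classical well-posedness of the scalar
  advection–diffusion equation with zero drift
  (`Torus.exists_unique_isClassicalScalarTransportForcedOn_holds`, Krylov 1996 Thm 9.2.3 as used
  by Cheskidov 2023 (4.2)), the conservation of the scalar mean
  (`Torus.IsClassicalScalarTransportOn.scalarMean_eq`) and the commutation of `∂ₜ`, `∂ⱼ`, `Δ` on
  jointly smooth fields (`Torus.timeDerivWithin_partialDeriv_comm`, `Torus.partialDeriv_laplacian_comm`).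

## Mathlib / tree search

Tree (used): `Torus.exists_unique_isClassicalScalarTransportOn_of_forced` /
`Torus.exists_unique_isClassicalScalarTransportForcedOn_holds` (`PassiveScalarWellPosedness(Proofs)`),
`Torus.IsClassicalScalarTransportOn.scalarMean_eq` (`PassiveScalarClassicalEnergy`),
`Torus.timeDerivWithin_clm_comp`, `Torus.timeDerivWithin_finset_sum`,
`Torus.timeDerivWithin_partialDeriv_comm`, `Torus.laplacian_clm_comp_apply`,
`Torus.partialDeriv_laplacian_comm` (`TorusInverseLaplacianCalculus`); Mathlib `EuclideanSpace.equiv`,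
`derivWithin_pi`, `contDiffOn_pi'`, `ContinuousLinearMap.integral_comp_comm`. Searched
(`lean search`): `Torus.*[Hh]eat|heatSemigroup|vHeat` — the tree has the torus heat KERNEL
(`TorusHeatKernel`, `TorusHeatSmoothing`), the forced scalar heat equation (`TorusHeatForcedIcc`)
and free-space heat flows (`MildSolution.heatFlow`), but no classical vector heat flow on `T^d`
with incompressibility and mean.

## References

* L. C. Evans, *Partial Differential Equations*, 2nd ed., AMS (2010), §2.3.1 (Thm 1: solution of
  the Cauchy problem for the heat equation), §2.3 Thm 5 / §7.1.2 (uniqueness). [Evans2010]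
* J. C. Robinson, W. Sadowski, Rend. Semin. Mat. Univ. Padova 131 (2014) 159–178, eq. (4) and
  p. 161 (heat flow of divergence-free data). [RobinsonSadowski2014]
* N. V. Krylov, *Lectures on Elliptic and Parabolic Equations in Hölder Spaces*, AMS (1996),
  Thm 9.2.3 (the scalar well-posedness behind `exists_unique_isClassicalScalarTransportForcedOn`).
  [Krylov1996]
-/

noncomputable section

open MeasureTheory Finset Set Filter Topology
open scoped InnerProductSpace RealInnerProductSpace ContDiff

namespace Literature.Analysis.FluidPDE

open Literature.Analysis.FunctionSpaces

variable {d : Type*} [Fintype d] [DecidableEq d]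

namespace VectorHeat

omit [DecidableEq d] in
/-- The zero vector field is jointly smooth on any time set. [folklore] -/
private theorem isSmoothSpaceTimeOn_zero (S : Set ℝ) :
    Torus.IsSmoothSpaceTimeOn S (fun (_ : ℝ) (_ : UnitAddTorus d) => (0 : EuclideanSpace ℝ d)) :=
  Torus.isSmoothSpaceTimeOn_const (Torus.isSmooth_const _) _

/-- The zero vector field is divergence free. [folklore] -/
private theorem isDivFree_zero : Torus.IsDivFree (fun _ : UnitAddTorus d => (0 : EuclideanSpace ℝ d)) := by
  intro x
  simp [Torus.divergence, Torus.partialDeriv, Torus.lineDeriv]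

/-- A scalar solution of `∂ₜθ + 0·∇θ = νΔθ` solves `∂ₜθ = νΔθ`. [folklore] -/
private theorem heat_of_transport {S : Set ℝ} {ν : ℝ} {θ : ℝ → UnitAddTorus d → ℝ}
    (h : Torus.IsClassicalScalarTransportOn S ν (fun (_ : ℝ) (_ : UnitAddTorus d) =>
      (0 : EuclideanSpace ℝ d)) θ) {t : ℝ} (ht : t ∈ S) (x : UnitAddTorus d) :
    Torus.timeDerivWithin S θ t x = ν * Torus.laplacian (θ t) x := by
  have := h.transport t ht x
  simpa using this

/-- Conversely, `∂ₜθ = νΔθ` with `θ` jointly smooth is a scalar transport solution with zero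
drift. [folklore] -/
private theorem transport_of_heat {S : Set ℝ} {ν : ℝ} {θ : ℝ → UnitAddTorus d → ℝ}
    (hθ : Torus.IsSmoothSpaceTimeOn S θ)
    (hheat : ∀ t ∈ S, ∀ x, Torus.timeDerivWithin S θ t x = ν * Torus.laplacian (θ t) x) :
    Torus.IsClassicalScalarTransportOn S ν (fun (_ : ℝ) (_ : UnitAddTorus d) =>
      (0 : EuclideanSpace ℝ d)) θ where
  smooth_velocity := isSmoothSpaceTimeOn_zero S
  smooth_scalar := hθ
  transport t ht x := by simpa using hheat t ht x
  divFree t _ := isDivFree_zero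

/-- `∂ⱼ(ν f) = ν ∂ⱼf` for `C¹` scalar `f`. [folklore] -/
private theorem partialDeriv_const_mul' {f : UnitAddTorus d → ℝ} (hf : Torus.IsContDiff 1 f)
    (ν : ℝ) (j : d) (x : UnitAddTorus d) :
    Torus.partialDeriv j (fun y => ν * f y) x = ν * Torus.partialDeriv j f x := by
  have hc : Torus.IsContDiff 1 (fun _ : UnitAddTorus d => ν) := contDiff_const
  have h := Torus.partialDeriv_smul hc hf j x
  have h0 : Torus.partialDeriv j (fun _ : UnitAddTorus d => ν) x = 0 := by
    simp [Torus.partialDeriv, Torus.lineDeriv]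
  simp only [smul_eq_mul] at h
  rw [h, h0, zero_mul, add_zero]

/-- The Laplacian of a finite sum of smooth scalar functions, through the summation map
`(d → ℝ) →L ℝ`. [folklore] -/
private theorem laplacian_sum_eq {g : d → UnitAddTorus d → ℝ} (hg : ∀ i, Torus.IsSmooth (g i))
    (x : UnitAddTorus d) :
    Torus.laplacian (fun y => ∑ i, g i y) x = ∑ i, Torus.laplacian (g i) x := by
  set G : UnitAddTorus d → (d → ℝ) := fun y i => g i y with hG
  have hGs : Torus.IsSmooth G := by
    unfold Torus.IsSmooth
    exact contDiff_pi.2 fun i => hg i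
  set Lsum : (d → ℝ) →L[ℝ] ℝ := ∑ i, ContinuousLinearMap.proj i with hLsum
  have hLsum_apply : ∀ f : d → ℝ, Lsum f = ∑ i, f i := by
    intro f; simp [hLsum]
  have e : (fun y => ∑ i, g i y) = Lsum ∘ G := by
    funext y; simp [hLsum_apply, hG]
  rw [e, Torus.laplacian_clm_comp_apply hGs Lsum x, hLsum_apply]
  refine Finset.sum_congr rfl fun i _ => ?_
  have e2 : g i = (ContinuousLinearMap.proj i : (d → ℝ) →L[ℝ] ℝ) ∘ G := by
    funext y; simp [hG]
  rw [e2, Torus.laplacian_clm_comp_apply hGs]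
  rfl

/-- The Laplacian of the zero scalar function vanishes. [folklore] -/
private theorem laplacian_zero_fun (x : UnitAddTorus d) :
    Torus.laplacian (fun _ : UnitAddTorus d => (0 : ℝ)) x = 0 := by
  rw [Torus.laplacian_eq_sum_partialDeriv_partialDeriv (Torus.isSmooth_const (0 : ℝ))]
  have hp : ∀ j, Torus.partialDeriv j (fun _ : UnitAddTorus d => (0 : ℝ)) = fun _ => 0 := by
    intro j; funext y; simp [Torus.partialDeriv, Torus.lineDeriv]
  simp [hp]

end VectorHeat

open VectorHeat

/-- **The classical heat flow of a smooth vector field on `T^d`** (Evans 2010 §2.3.1; the object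
"`v(t)` = the solution of the heat equation with initial data `u₀`" of Robinson–Sadowski 2014,
(4), for which "the divergence-free property of `u₀` is preserved by the heat semigroup", p. 161).
For `ν > 0`, `T > 0` and smooth `u₀ : T^d → ℝ^d` there is `v`, jointly smooth on `[0, T] × T^d`,
with `∂ₜv = νΔv` (one-sided time derivative within `[0, T]`) and `v(0) = u₀`; if `div u₀ = 0` then
`div v(t) = 0` on `[0, T]`; if `∫u₀ = 0` then `∫v(t) = 0` on `[0, T]`; and every jointly smooth
solution of `∂ₜv' = νΔv'` on `[0, T]` with `v'(0) = u₀` equals `v` on `[0, T]`. Componentwise from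
the scalar well-posedness (`Torus.exists_unique_isClassicalScalarTransportForcedOn_holds`, zero
drift); `div v` and `∫v` are handled as scalar heat solutions / conserved means.
[cite: Evans2010, §2.3.1 Thm 1 and §2.3 Thm 5] [cite: RobinsonSadowski2014, eq. (4) and p. 161] -/
theorem Torus.exists_classical_heatFlow {ν T : ℝ} (hν : 0 < ν) (hT : 0 < T)
    {u₀ : UnitAddTorus d → EuclideanSpace ℝ d} (hu₀ : Torus.IsSmooth u₀) :
    ∃ v : ℝ → UnitAddTorus d → EuclideanSpace ℝ d,
      Torus.IsSmoothSpaceTimeOn (Icc 0 T) v ∧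
      (∀ t ∈ Icc 0 T, ∀ x, Torus.timeDerivWithin (Icc 0 T) v t x = ν • Torus.laplacian (v t) x) ∧
      v 0 = u₀ ∧
      (Torus.IsDivFree u₀ → ∀ t ∈ Icc 0 T, Torus.IsDivFree (v t)) ∧
      (Torus.HasZeroMean u₀ → ∀ t ∈ Icc 0 T, Torus.HasZeroMean (v t)) ∧
      (∀ v' : ℝ → UnitAddTorus d → EuclideanSpace ℝ d, Torus.IsSmoothSpaceTimeOn (Icc 0 T) v' →
        (∀ t ∈ Icc 0 T, ∀ x, Torus.timeDerivWithin (Icc 0 T) v' t x = ν • Torus.laplacian (v' t) x) →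
        v' 0 = u₀ → ∀ t ∈ Icc 0 T, v' t = v t) := by
  set S : Set ℝ := Icc 0 T with hS
  have hU : UniqueDiffOn ℝ S := uniqueDiffOn_Icc hT
  -- ### the scalar components
  have hsc : ∀ i : d, ∃ θ : ℝ → UnitAddTorus d → ℝ,
      Torus.IsClassicalScalarTransportOn S ν (fun (_ : ℝ) (_ : UnitAddTorus d) =>
        (0 : EuclideanSpace ℝ d)) θ ∧ θ 0 = (fun x => u₀ x i) ∧
      ∀ θ' : ℝ → UnitAddTorus d → ℝ, Torus.IsClassicalScalarTransportOn S ν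
        (fun (_ : ℝ) (_ : UnitAddTorus d) => (0 : EuclideanSpace ℝ d)) θ' →
        θ' 0 = (fun x => u₀ x i) → ∀ t ∈ S, θ' t = θ t := fun i =>
    Torus.exists_unique_isClassicalScalarTransportOn_of_forced
      Torus.exists_unique_isClassicalScalarTransportForcedOn_holds hν hT (isSmoothSpaceTimeOn_zero S)
      (fun _ _ => isDivFree_zero) (hu₀.apply i)
  choose θ hθ hθ0 huniq using hsc
  have hθs : ∀ i, Torus.IsSmoothSpaceTimeOn S (θ i) := fun i => (hθ i).smooth_scalar
  have hheat : ∀ i, ∀ t ∈ S, ∀ x, Torus.timeDerivWithin S (θ i) t x = ν * Torus.laplacian (θ i t) x :=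
    fun i t ht x => heat_of_transport (hθ i) ht x
  -- ### assembling the vector field through `EuclideanSpace.equiv`
  set Θ : ℝ → UnitAddTorus d → (d → ℝ) := fun t x i => θ i t x with hΘ
  set L : (d → ℝ) →L[ℝ] EuclideanSpace ℝ d :=
    (EuclideanSpace.equiv d ℝ).symm.toContinuousLinearMap with hL
  have hLapply : ∀ (f : d → ℝ) (i : d), L f i = f i := by
    intro f i; simp [hL]
  have hLu : ∀ x, L (fun i => u₀ x i) = u₀ x := by
    intro x
    ext i
    rw [hLapply]
  set v : ℝ → UnitAddTorus d → EuclideanSpace ℝ d := fun t x => L (Θ t x) with hv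
  have hΘs : Torus.IsSmoothSpaceTimeOn S Θ := by
    unfold Torus.IsSmoothSpaceTimeOn
    exact contDiffOn_pi' fun i => hθs i
  have hΘt : ∀ t ∈ S, Torus.IsSmooth (Θ t) := fun t ht => hΘs.isSmooth_slice ht
  have hvs : Torus.IsSmoothSpaceTimeOn S v := hΘs.clm_comp L
  -- time derivative and Laplacian of `Θ`, componentwise
  have hΘderiv : ∀ t ∈ S, ∀ x, Torus.timeDerivWithin S Θ t x = fun i => Torus.timeDerivWithin S (θ i) t x := by
    intro t ht x
    unfold Torus.timeDerivWithin
    exact derivWithin_pi (fun i => ((hθs i).hasDerivWithinAt_slice ht x).differentiableWithinAt)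
  have hΘlap : ∀ t ∈ S, ∀ x i, Torus.laplacian (Θ t) x i = Torus.laplacian (θ i t) x := by
    intro t ht x i
    have e : θ i t = (ContinuousLinearMap.proj i : (d → ℝ) →L[ℝ] ℝ) ∘ Θ t := by
      funext y; simp [hΘ]
    rw [e, Torus.laplacian_clm_comp_apply (hΘt t ht)]
    rfl
  -- ### the heat equation for `v`
  have hvheat : ∀ t ∈ S, ∀ x, Torus.timeDerivWithin S v t x = ν • Torus.laplacian (v t) x := by
    intro t ht x
    have h1 : Torus.timeDerivWithin S v t x = L (Torus.timeDerivWithin S Θ t x) :=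
      Torus.timeDerivWithin_clm_comp hΘs hU L ht x
    have h2 : Torus.laplacian (v t) x = L (Torus.laplacian (Θ t) x) :=
      Torus.laplacian_clm_comp_apply (hΘt t ht) L x
    rw [h1, h2, hΘderiv t ht x, ← map_smul]
    congr 1
    funext i
    rw [Pi.smul_apply, hΘlap t ht x i, hheat i t ht x, smul_eq_mul]
  -- ### the datum
  have hv0 : v 0 = u₀ := by
    funext x
    show L (fun i => θ i 0 x) = u₀ x
    have e : (fun i => θ i 0 x) = fun i => u₀ x i := by
      funext i; rw [hθ0 i]
    rw [e, hLu]
  -- components of `v`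
  have hvi : ∀ t x i, v t x i = θ i t x := by
    intro t x i
    show L (Θ t x) i = θ i t x
    rw [hLapply]
  refine ⟨v, hvs, hvheat, hv0, ?_, ?_, ?_⟩
  · -- ### incompressibility: `div v` solves the scalar heat equation with zero datum
    intro hdiv0 t ht
    set D : ℝ → UnitAddTorus d → ℝ := fun s => Torus.divergence (v s) with hD
    have hDs : Torus.IsSmoothSpaceTimeOn S D := hvs.divergence hU
    have hDsum : ∀ s, D s = fun y => ∑ i, Torus.partialDeriv i (θ i s) y := by
      intro s; funext y
      simp only [hD, Torus.divergence]
      refine Finset.sum_congr rfl fun i _ => ?_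
      have e : (fun y => v s y i) = θ i s := by funext y; exact hvi s y i
      rw [e]
    -- `∂ₜD = νΔD`
    have hDheat : ∀ s ∈ S, ∀ x, Torus.timeDerivWithin S D s x = ν * Torus.laplacian (D s) x := by
      intro s hs x
      have eD : D = fun s y => ∑ i, Torus.partialDeriv i (θ i s) y := by
        funext s; exact hDsum s
      have hPs : ∀ i, Torus.IsSmoothSpaceTimeOn S (fun s => Torus.partialDeriv i (θ i s)) :=
        fun i => (hθs i).partialDeriv hU i
      rw [eD, Torus.timeDerivWithin_finset_sum Finset.univ (fun i _ => hPs i) hU hs x]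
      rw [laplacian_sum_eq (fun i => ((hθs i).isSmooth_slice hs).partialDeriv i) x, Finset.mul_sum]
      refine Finset.sum_congr rfl fun i _ => ?_
      rw [Torus.timeDerivWithin_partialDeriv_comm hT (hθs i) hs i x]
      have e1 : Torus.timeDerivWithin S (θ i) s = fun y => ν * Torus.laplacian (θ i s) y := by
        funext y; exact hheat i s hs y
      have hθis : Torus.IsSmooth (θ i s) := (hθs i).isSmooth_slice hs
      rw [show Torus.timeDerivWithin (Icc 0 T) (θ i) s = Torus.timeDerivWithin S (θ i) s from rfl, e1,
        partialDeriv_const_mul' (hθis.laplacian.isContDiff (by simp)) ν i x,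
        Torus.partialDeriv_laplacian_comm hθis i x]
    have hDsol := transport_of_heat hDs hDheat
    -- the unique scalar solution with zero datum is zero
    have hzero : Torus.IsSmoothSpaceTimeOn S (fun (_ : ℝ) (_ : UnitAddTorus d) => (0 : ℝ)) :=
      Torus.isSmoothSpaceTimeOn_const (Torus.isSmooth_const _) _
    have hzheat : ∀ s ∈ S, ∀ x, Torus.timeDerivWithin S (fun (_ : ℝ) (_ : UnitAddTorus d) => (0 : ℝ)) s x =
        ν * Torus.laplacian ((fun (_ : ℝ) (_ : UnitAddTorus d) => (0 : ℝ)) s) x := by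
      intro s hs x
      have h1 : Torus.timeDerivWithin S (fun (_ : ℝ) (_ : UnitAddTorus d) => (0 : ℝ)) s x = 0 := by
        simp [Torus.timeDerivWithin]
      have h2 : Torus.laplacian (fun _ : UnitAddTorus d => (0 : ℝ)) x = 0 := laplacian_zero_fun x
      rw [h1]
      show (0 : ℝ) = ν * Torus.laplacian (fun _ : UnitAddTorus d => (0 : ℝ)) x
      rw [h2, mul_zero]
    have hzsol := transport_of_heat hzero hzheat
    obtain ⟨θz, -, -, huz⟩ := Torus.exists_unique_isClassicalScalarTransportOn_of_forced
      Torus.exists_unique_isClassicalScalarTransportForcedOn_holds hν hT (isSmoothSpaceTimeOn_zero S)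
      (fun _ _ => isDivFree_zero) (Torus.isSmooth_const (d := d) (0 : ℝ))
    have hD0 : D 0 = fun _ => (0 : ℝ) := by
      funext y
      show Torus.divergence (v 0) y = 0
      rw [hv0]; exact hdiv0 y
    have h1 := huz D hDsol hD0 t ht
    have h2 := huz (fun _ _ => (0 : ℝ)) hzsol rfl t ht
    intro y
    show D t y = 0
    rw [h1, ← h2]
  · -- ### the mean
    intro hmean t ht
    have hΘc : Continuous (Θ t) := (hΘt t ht).continuous
    have hint : Integrable (Θ t) volume := hΘc.integrable_unitAddTorus
    unfold Torus.HasZeroMean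
    show ∫ x, L (Θ t x) = 0
    rw [ContinuousLinearMap.integral_comp_comm L hint]
    have hcomp : ∀ i, (∫ x, Θ t x) i = 0 := by
      intro i
      have h1 : (∫ x, Θ t x) i = ∫ x, θ i t x := by
        have := (ContinuousLinearMap.integral_comp_comm
          (ContinuousLinearMap.proj i : (d → ℝ) →L[ℝ] ℝ) hint).symm
        simpa [hΘ] using this
      have h2 : Torus.scalarMean (θ i t) = Torus.scalarMean (θ i 0) :=
        (hθ i).scalarMean_eq subset_rfl ht
      have h3 : ∫ x, θ i 0 x = 0 := by
        rw [hθ0 i]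
        have := (ContinuousLinearMap.integral_comp_comm (EuclideanSpace.proj i : EuclideanSpace ℝ d →L[ℝ] ℝ)
          hu₀.continuous.integrable_unitAddTorus)
        have hm : ∫ x, u₀ x = 0 := hmean
        simp only [EuclideanSpace.coe_proj, hm, map_zero] at this
        exact this
      rw [h1]
      unfold Torus.scalarMean at h2
      rw [h2, h3]
    have : (∫ x, Θ t x) = 0 := funext hcomp
    rw [this, map_zero]
  · -- ### uniqueness, componentwise
    intro v' hv's hv'heat hv'0 t ht
    have hcomp : ∀ i, (fun s x => v' s x i) t = θ i t := by
      intro i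
      have hθ's : Torus.IsSmoothSpaceTimeOn S (fun s x => v' s x i) := hv's.apply i
      have hθ'heat : ∀ s ∈ S, ∀ x, Torus.timeDerivWithin S (fun s x => v' s x i) s x =
          ν * Torus.laplacian ((fun s x => v' s x i) s) x := by
        intro s hs x
        have h1 := Torus.timeDerivWithin_clm_comp hv's hU (EuclideanSpace.proj i) hs x
        have h2 := Torus.laplacian_clm_comp_apply (hv's.isSmooth_slice hs) (EuclideanSpace.proj i) x
        simp only [EuclideanSpace.coe_proj] at h1 h2
        rw [h1, hv'heat s hs x]
        show (ν • Torus.laplacian (v' s) x) i = ν * Torus.laplacian (fun x => v' s x i) x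
        have e : (fun x => v' s x i) = (fun y => (v' s y) i) := rfl
        rw [PiLp.smul_apply, smul_eq_mul]
        congr 1
        exact h2.symm
      have h0' : (fun s x => v' s x i) 0 = fun x => u₀ x i := by
        funext x; simp [hv'0]
      exact huniq i _ (transport_of_heat hθ's hθ'heat) h0' t ht
    funext x
    ext i
    rw [hvi t x i]
    have := congrFun (hcomp i) x
    exact this

/-! ## Robinson–Sadowski's Theorem 5 with the heat flow determined by the datum -/

/-- **Robinson–Sadowski 2014, Theorem 5, with the heat-flow hypothesis reduced to the printed one.**
In `Torus.classicalNS_continuation_of_heatFlow_criterion` (`TorusNSHeatFlowCriterion`) the heat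
flow `v` of the datum carries, besides `∂ₜv = νΔv` and `v(0) = u(0)`, the hypotheses that its
slices are divergence free and mean zero. By `Torus.exists_classical_heatFlow` these are automatic:
a jointly smooth solution of `∂ₜv = νΔv` on `[0, T] × T^d` with `v(0) = u(0)` is unique, and the
one constructed there has divergence-free mean-zero slices because `u(0)` does. Hence: there is
`ε = ε(d) > 0` such that for every classical mean-zero solution `(u, p)` of the unforced
Navier–Stokes equations (`ν > 0`) on `[0, T) × T^d`, `card d = 3`, and every jointly smooth `v` on
`[0, T] × T^d` with `∂ₜv = νΔv` and `v(0) = u(0)` — "the solution of the heat equation with initial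
data `u₀`" — the bound `(∫‖u(0)‖³) ∫₀ᵗ∫‖v‖∑ₖ‖∂ₖv‖² ≤ εν⁵` for `t < T` implies that `u` continues
to a classical mean-zero solution past `T`. [cite: RobinsonSadowski2014, Theorem 5 (pp. 169–171)] -/
theorem Torus.classicalNS_continuation_of_heatFlow_criterion' (hd : Fintype.card d = 3) :
    ∃ ε : ℝ, 0 < ε ∧ ∀ {ν T : ℝ}, 0 < ν → 0 < T →
      ∀ {u v : ℝ → UnitAddTorus d → EuclideanSpace ℝ d} {p : ℝ → UnitAddTorus d → ℝ},
        Torus.IsClassicalNSSolutionOn (Ico 0 T) ν 0 u p →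
        (∀ t ∈ Ico 0 T, Torus.HasZeroMean (u t)) →
        Torus.IsSmoothSpaceTimeOn (Icc 0 T) v →
        (∀ t ∈ Icc 0 T, ∀ x, Torus.timeDerivWithin (Icc 0 T) v t x = ν • Torus.laplacian (v t) x) →
        v 0 = u 0 →
        (∀ t ∈ Ico 0 T, (∫ x, ‖u 0 x‖ ^ (3 : ℝ)) *
            ∫ s in (0 : ℝ)..t, ∫ x, ‖v s x‖ * ∑ k, ‖Torus.partialDeriv k (v s) x‖ ^ 2 ≤ ε * ν ^ 5) →
        ∃ T' : ℝ, T < T' ∧ ∃ (u' : ℝ → UnitAddTorus d → EuclideanSpace ℝ d)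
          (p' : ℝ → UnitAddTorus d → ℝ), Torus.IsClassicalNSSolutionOn (Icc 0 T') ν 0 u' p' ∧
            (∀ t ∈ Icc 0 T', Torus.HasZeroMean (u' t)) ∧ ∀ t ∈ Ico 0 T, u' t = u t := by
  obtain ⟨ε, hε, hmain⟩ := Torus.classicalNS_continuation_of_heatFlow_criterion (d := d) hd
  refine ⟨ε, hε, fun {ν T} hν hT {u v p} h hmean hv hheat hv0 hsmall => ?_⟩
  have h0 : (0 : ℝ) ∈ Ico 0 T := ⟨le_rfl, hT⟩
  have hu0 : Torus.IsSmooth (u 0) := h.smooth_velocity.isSmooth_slice h0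
  -- the heat flow of `u(0)` with its properties, and uniqueness
  obtain ⟨w, hws, hwheat, hw0, hwdiv, hwmean, hwuniq⟩ :=
    Torus.exists_classical_heatFlow (d := d) hν hT hu0
  have hvw : ∀ t ∈ Icc 0 T, v t = w t := hwuniq v hv hheat hv0
  have hsub : Ico 0 T ⊆ Icc 0 T := Ico_subset_Icc_self
  have hU : UniqueDiffOn ℝ (Ico 0 T) := uniqueDiffOn_Ico 0 T
  -- restriction of the heat equation to `[0, T)`
  have hv' : Torus.IsSmoothSpaceTimeOn (Ico 0 T) v := hv.mono hsub
  have hheat' : ∀ t ∈ Ico 0 T, ∀ x,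
      Torus.timeDerivWithin (Ico 0 T) v t x = ν • Torus.laplacian (v t) x := by
    intro t ht x
    have hder := ((hv.hasDerivWithinAt_slice (hsub ht) x).mono hsub).derivWithin (hU t ht)
    unfold Torus.timeDerivWithin at hder ⊢
    rw [hder]
    exact hheat t (hsub ht) x
  have hdiv' : ∀ t ∈ Ico 0 T, Torus.IsDivFree (v t) := fun t ht => by
    rw [hvw t (hsub ht)]; exact hwdiv (h.divFree 0 h0) t (hsub ht)
  have hmean' : ∀ t ∈ Ico 0 T, Torus.HasZeroMean (v t) := fun t ht => by
    rw [hvw t (hsub ht)]; exact hwmean (hmean 0 h0) t (hsub ht)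
  exact hmain hν hT h hmean hv' hheat' hdiv' hmean' hv0 hsmall

end Literature.Analysis.FluidPDE
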